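/-
Origin: expansion seat `prover-pub-hodgecm-mc-binder-1-g13-0`, handover #65 2026-08-20T13:44:28Z md5 69f82fd37c16 (NEW additive KERNEL leaf; imports HypCensus/Side34Omg + Model/ArchConjTorusTransport; drops ⇒ {#66,#67,#68}) (`HOME/mc/pub-hodgecm-mc-binder-1-g13/stage52/HodgeCM/Model/Binders/Real34TwistTransport.lean`, md5 69f82fd37c16, 101 lines);
landed by the second packager p2 gen 8 (p2-g8) in gate run 52 as `HodgeCM/Model/Binders/Real34TwistTransport.lean` (verbatim).
-/
/-
Origin: speedrun cell pub-hodgecm, MODEL-CONSTRUCTION sub-cell, unit pub-hodgecm-mc-binder-1-g13 (BINDER PROVER, gen 13; row 17 `real34`: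
the archimedean letter identity `harch` of the socket `Real34CensusSideT.ofCensus`, junction binder-2 ↔ theta-3), seat
prover-pub-hodgecm-mc-binder-1-g13-0, 2026-08-20.  Target in PKG: HodgeCM/Model/Binders/Real34TwistTransport.lean (NEW additive leaf;
imports binder-2's `HypCensus/Side34Omg` (`isoTwistPin`) and theta-3's (K7) `Model/ArchConjTorusTransport` (`conjTransportK`)).
KERNEL ONLY: theorems; 0 defs, 0 records, nothing cited, 0 `def … : Prop`; MODEL-N ±0; E unchanged.  Nothing here is a claim of the manuscripts
under adjudication.
-/
import Summits.HodgeConjecture.HodgeCM.Model.HypCensus.Side34Omg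
import Summits.HodgeConjecture.HodgeCM.Model.ArchConjTorusTransport_2

/-!
# binder-2's archimedean twist of the pin IS theta-3's transport element: `isoTwistPin S = conjTransportK S`

Two lanes built the element of `U(diag(a₀,a₁))(L⁺ ⊗ ℝ)` that conjugates the `(34)` torus `isoGL · diag(u) · isoGL⁻¹` to a diagonal
torus: binder-2's `isoTwist` (#52 `HypCensus/IsoTwist`, components `σ_w(isoGL) · (isoMat_w)⁻¹`, used in the `(34)` census insertion
`ins₃₄`, hence in row 17's `archVec₃₄`) and theta-3's (K7) `conjTransportK S = archGL(isoGL) · (P_σ Λ)` (used by sinst-1's (VT)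
`ArchConjLeviVT.exists_reindex_archFactor_eq_smul_cmArchWeilRep_cmConjSeesawMp`, which identifies the archimedean factor of the see-saw lift
`ω(r_F h₀)` with `c • ω_∞(1, conjTransportK S) ∘ (· ∘ J_S)`).  They are EQUAL on the nose:

* `isoMatInv_placeRe_eq_transportMatAt` — at every place `w`, binder-2's `(isoMat_w)⁻¹` (entry `(√(a′ᵢ/a_{σ i}))⁻¹` in column `σ i`)
  is theta-3's `P_σ Λ` through `w` (entry `√(a_{σ i}/a′ᵢ)` in column `σ i`; same bit `σ_w`: «`a₀`, `a′₀` of opposite signs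
  through `w`»), by `√(x/x′) = (√(x′/x))⁻¹`;
* **`isoTwistPin_eq_conjTransportK`** — `isoTwistPin S = conjTransportK S` (compared through the complex coordinates `evalC w`:
  binder-2's `archAt_isoTwist`, theta-3's `val_archGL_map_evalC` / `transportMat_map_evalC` / `matrix_mixedSpace_eq_of_evalC`).

Use (row 17, `harch` (i″) of binder-1's `HARCH-PLAN.md` §6): with this identification sinst-1's (VT) is the statement
`ω_∞(1, isoTwistPin) = c • A_∞ ∘ S_∞` that `HARCH-PLAN.md` §8 asked for — no new adelic computation is needed.
-/

set_option autoImplicit false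

noncomputable section

open NumberField NumberField.InfinitePlace
open scoped Matrix Classical
open Literature.NumberTheory.Automorphic Literature.NumberTheory.Automorphic.UnitaryGroup
open HodgeCM.PerL34 HodgeCM.Model.HypCensus HodgeCM.Model.ArchSideTerm

namespace HodgeCM.Model

section TwoByTwo

variable {L : CMField} (S : StubTree.SeesawDatum L) (w : InfinitePlace (L : Type))

/-- `(√r)⁻¹ = √(r⁻¹)` read on a quotient: `((√(b/a) : ℝ) : ℂ)⁻¹ = √(a/b)`. -/
private theorem ofReal_sqrt_div_inv (a b : ℝ) :
    (((Real.sqrt (b / a) : ℝ) : ℂ))⁻¹ = ((Real.sqrt (a / b) : ℝ) : ℂ) := by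
  rw [← Complex.ofReal_inv, ← Real.sqrt_inv, inv_div]

/-- **binder-2's `(isoMat_w)⁻¹` is theta-3's `P_σ Λ` through `w`.** -/
theorem isoMatInv_placeRe_eq_transportMatAt :
    isoMatInv (placeRe (L : Type) (dW S) w) (placeRe (L : Type) (dW' S) w) = transportMatAt S w := by
  by_cases h : (0 < (w.embedding (dW S 0)).re ↔ 0 < (w.embedding (dW' S 0)).re)
  · -- no swap at `w`
    have hσ : isoPerm (placeRe (L : Type) (dW S) w) (placeRe (L : Type) (dW' S) w) = 1 := if_pos h
    have hb : ¬ conjSwapAt S w := not_not.mpr h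
    have hbit : ∀ j, bitPerm S w j = j := fun j => if_neg hb
    rw [transportMatAt, if_neg hb]
    ext i j
    simp only [isoMatInv, isoScale, hσ, Equiv.Perm.coe_one, id_eq, Matrix.of_apply, transportScale, hbit, placeRe]
    fin_cases i <;> fin_cases j <;> simp [ofReal_sqrt_div_inv]
  · -- swap at `w`
    have hσ : isoPerm (placeRe (L : Type) (dW S) w) (placeRe (L : Type) (dW' S) w) = Equiv.swap 0 1 := if_neg h
    have hb : conjSwapAt S w := h
    have hbit : ∀ j, bitPerm S w j = Equiv.swap 0 1 j := fun j => if_pos hb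
    rw [transportMatAt, if_pos hb]
    ext i j
    simp only [isoMatInv, isoScale, hσ, Matrix.of_apply, transportScale, hbit, placeRe]
    fin_cases i <;> fin_cases j <;> simp [ofReal_sqrt_div_inv, Equiv.swap_apply_left, Equiv.swap_apply_right]

end TwoByTwo

section Pin

variable {L : CMField} (S : StubTree.SeesawDatum L)

/-- **binder-2's twist of the pin IS theta-3's transport element**: `isoTwistPin S = conjTransportK S` in `U(diag(a₀,a₁))(L⁺ ⊗ ℝ)`. -/
theorem isoTwistPin_eq_conjTransportK : isoTwistPin S = conjTransportK S := by
  apply Subtype.ext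
  apply Units.ext
  refine matrix_mixedSpace_eq_of_evalC _ _ fun w => ?_
  -- binder-2's side through `w`: `archAt w (isoTwist) = isoLoc w`, whose matrix is `σ_w(isoGL) · (isoMat_w)⁻¹`
  have hL := congrArg (fun g : ↥(archLocal (L : Type) 2 (Matrix.diagonal (dW S)) w) => ((g : GL (Fin 2) ℂ) : Matrix (Fin 2) (Fin 2) ℂ))
    (archAt_isoTwist (L : Type) (dW S) (dW' S) (dW_real S) (dW_ne S) (dW'_real S) (dW'_ne S) S.isoGL (isoGL_hg₀ S) w)
  have hL' : (((isoTwistPin S : ↥(UnitaryGroup.arch (↥(maximalRealSubfield (L : Type))) (L : Type) (IsCMField.complexConj (L : Type)) 2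
        (Matrix.diagonal (dW S)))) : GL (Fin 2) (NumberField.mixedEmbedding.mixedSpace (L : Type))) :
        Matrix (Fin 2) (Fin 2) (NumberField.mixedEmbedding.mixedSpace (L : Type))).map (evalC (L : Type) w) =
      ((S.isoGL : GL (Fin 2) (L : Type)) : Matrix (Fin 2) (Fin 2) (L : Type)).map w.1.embedding *
        isoMatInv (placeRe (L : Type) (dW S) w.1) (placeRe (L : Type) (dW' S) w.1) := by
    refine hL.trans ?_
    rfl
  rw [hL', coe_conjTransportK, Units.val_mul, Matrix.map_mul, val_archGL_map_evalC, val_conjTransportGL, transportMat_map_evalC,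
    isoMatInv_placeRe_eq_transportMatAt]
  rfl

end Pin

end HodgeCM.Model

end
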